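import Summits.Langlands.Langlands.Theses.TriangulineChamber
import Literature.NumberTheory.GaloisRepresentations.UnramifiedDatum
import Literature.NumberTheory.Automorphic.LocalLanglandsDatumProofs

/-!
# Route TriangulineChamber — `ReciprocityDataInputs` (item stmt-Langlands-9501) reduced to the
# local Langlands correspondence for `GL_n`

The support item `ReciprocityDataInputs` of route `TriangulineChamber` (the NEEDS-FACT CARRIER of the
route's `∃ RD`-shaped items; the same statement is `WachCensus.ReciprocityDataInputs`,
`WachComponentCensus.ReciprocityDataInputs`) is the conjunction of the two named Literature facts
without which no term of `ReciprocityData F` exists: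

* `Literature.NumberTheory.Automorphic.LocalLanglandsDatum.nonempty` — the local Langlands
  correspondence for the general linear groups over every non-archimedean local field, with `L`- and
  `ε`-factors of pairs (Harris–Taylor 2001, Thm. A; Henniart 2000, Thm. 1.2), bundled as a datum;
* `Literature.NumberTheory.GaloisRepresentations.PstWeilDeligneData.nonempty` — Fontaine's `p`-adic
  Hodge datum (`B_dR`, `WD ∘ D_pst`) at `v ∣ ℓ`, as a datum with prescribed `ℚ_ℓ`-algebra structure.

What this file proves.

* The SECOND conjunct holds in the tree: `PstWeilDeligneData.nonempty_holds`
  (`Literature/NumberTheory/GaloisRepresentations/PstWeilDeligneProofs`, landed from this item),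
  witnessed by the accepted `F̂_nr`-datum `unramifiedPstWeilDeligneData` (period ring
  `(B_dR)^{I_F}`, Weil–Deligne recipe `(ρ|_{W_F}, N = 0)`; all axioms of the structure are
  theorems — Fontaine 1994 Exp. III Prop. 1.6.2, Lang's theorem).  This file uses that witness
  inline (importing only `UnramifiedDatum`).  Hence `ReciprocityDataInputs ↔ LocalLanglandsDatum.nonempty`
  (`ReciprocityDataInputs_iff_localLanglandsDatum_nonempty`): the item is EXACTLY the local
  Langlands correspondence for `GL_n` as a named fact, nothing more.
* `ReciprocityDataInputs_of_localLanglandsDatum_nonempty` — the item, CONDITIONAL on that one named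
  fact (a `conditional-result`; it does not close the item).
* `ReciprocityDataInputs_of_localLanglands_gl` — the same from the fact's printed constituents, via
  the accepted reduction `LocalLanglandsDatum.nonempty_of`: the existence statement
  `localLanglands_gl` (lang.S09, Harris–Taylor Thm. A / Henniart Thm. 1.2) at every `F` and system of
  local constants `𝓔`, and Deligne's existence theorem `nonempty_localEpsilonSystem` (Deligne 1973,
  Thm. 4.1) at every `F`.

What is NOT here: a proof of `LocalLanglandsDatum.nonempty`.  Its property `IsLocalLanglandsGL`
(bijections `Irr(GL_n(F)) ≃ {Frobenius-semisimple WD reps}/≅` for all `n`, local class field theory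
at `n = 1`, JPSS `L`/`ε` of pairs for generic pairs, twists, central characters) is the genuine
theorem of Harris–Taylor/Henniart (the fact quantifies over every `F : Type` carrying
`IsNonarchimedeanLocalField`, so in positive characteristic it is Laumon–Rapoport–Stuhler); it
admits no truncated witness and is far outside reach of the tree (in the tree it reduces, by the
accepted `LocalLanglandsDatum.nonempty_of`, to the named facts `localLanglands_gl` and
`nonempty_localEpsilonSystem`, Deligne's existence theorem for the local constants, both
undischarged).  The item therefore stays open, blocked on exactly that named fact.

Remark on the second conjunct (for the planners).  `PstWeilDeligneData.nonempty` AS STATED asks only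
for inhabitedness with a prescribed `algebra` field, and the truncated `F̂_nr`-datum provides it; so
this conjunct never carried Fontaine's `B_dR`/`D_pst` content (cf. the item's evidence note
CONE-NOTE-9501, and the pinned T0 named fact `Literature.NumberTheory.PAdicHodge.FontaineDatumExists`,
from which the accepted `PstWeilDeligneData.nonempty_of_fontaineDatumExists` also derives it).  In
the `∃ RD` items of this route the intended datum is pinned instead by the cyclotomic-weight clause
(`labelledHodgeTateWeightsAt … = {-m}` for the powers `ε^m`; route docstring: "this second pin
defeats junk filtrations on `RD.pst.𝔅`"), not by this carrier.

No new definitions; axioms `propext`, `Classical.choice`, `Quot.sound`.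
-/

noncomputable section

set_option linter.dupNamespace false -- project-wide option (lakefile weak.linter.dupNamespace); `Summit.Langlands.Langlands` is the mandated namespace

open Literature.NumberTheory.Automorphic Literature.NumberTheory.GaloisRepresentations

namespace Summit.Langlands.Langlands.Theorems

/-- **`ReciprocityDataInputs` is exactly the local Langlands correspondence for `GL_n`** (as the
named fact `LocalLanglandsDatum.nonempty`): the second conjunct `PstWeilDeligneData.nonempty` being
a theorem of the tree — witnessed inline by the accepted truncated `F̂_nr`-datum
`unramifiedPstWeilDeligneData F ℓ`, whose `algebra` field is the ambient structure by `rfl` (the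
same term as the Literature discharge `PstWeilDeligneData.nonempty_holds`, `PstWeilDeligneProofs`;
inhabitedness only, no `B_dR`/`D_pst` content) — the item is equivalent to its first conjunct. -/
theorem ReciprocityDataInputs_iff_localLanglandsDatum_nonempty :
    Theses.TriangulineChamber.ReciprocityDataInputs ↔ LocalLanglandsDatum.nonempty :=
  ⟨fun h => h.1, fun h => ⟨h, fun F _ _ _ _ ℓ _ _ _ => ⟨unramifiedPstWeilDeligneData F ℓ, rfl⟩⟩⟩

/-- **`ReciprocityDataInputs`, conditional on the local Langlands correspondence for `GL_n`**
(named fact `LocalLanglandsDatum.nonempty`: Harris–Taylor 2001 Thm. A, Henniart 2000 Thm. 1.2).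
CONDITIONAL RESULT — the hypothesis is an undischarged named fact; this does not close the item. -/
theorem ReciprocityDataInputs_of_localLanglandsDatum_nonempty (hLL : LocalLanglandsDatum.nonempty) :
    Theses.TriangulineChamber.ReciprocityDataInputs :=
  ReciprocityDataInputs_iff_localLanglandsDatum_nonempty.2 hLL

/-- **`ReciprocityDataInputs` from the printed constituents of the local Langlands datum**: if over
every non-archimedean local field `F` (in `Type`) and for every system of local constants `𝓔` the
local Langlands correspondence for the general linear groups exists with the normalisation
`(𝓔.artin F, 𝓔)` (named fact `localLanglands_gl`, lang.S09 — Harris–Taylor 2001 Thm. A / Henniart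
2000 Thm. 1.2 — taken at the discharged threaded `LocalGaloisGroup` facts), and over every such `F` a
system of local constants exists (named fact `nonempty_localEpsilonSystem`, Deligne 1973 Thm. 4.1),
then `ReciprocityDataInputs` holds (accepted reduction `LocalLanglandsDatum.nonempty_of` and
`ReciprocityDataInputs_iff_localLanglandsDatum_nonempty`).  CONDITIONAL RESULT on those two named
facts. -/
theorem ReciprocityDataInputs_of_localLanglands_gl
    (hgl : ∀ (F : Type) [Field F] [ValuativeRel F] [TopologicalSpace F]
      [IsNonarchimedeanLocalField F] (𝓔 : LocalEpsilonSystem F),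
      localLanglands_gl F IsFrobPow.mul_holds IsFrobPow.unique_holds (absInertia_normal_holds F)
        (exists_isFrobPow_holds F) WeilGroup.exists_subgroup_le_inertia_isOpen_of_continuous_holds
        (𝓔.artin F) 𝓔 rfl)
    (heps : ∀ (F : Type) [Field F] [ValuativeRel F] [TopologicalSpace F]
      [IsNonarchimedeanLocalField F], nonempty_localEpsilonSystem F) :
    Theses.TriangulineChamber.ReciprocityDataInputs :=
  ReciprocityDataInputs_iff_localLanglandsDatum_nonempty.2 (LocalLanglandsDatum.nonempty_of hgl heps)

/-- Conversely the item carries the local Langlands datum: `ReciprocityDataInputs` inhabits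
`LocalLanglandsDatum F` for every non-archimedean local field `F`, and in particular yields Deligne's
local constants over every `F` (`LocalLanglandsDatum.nonempty_localEpsilonSystem_of_nonempty`). -/
theorem nonempty_localEpsilonSystem_of_reciprocityDataInputs
    (h : Theses.TriangulineChamber.ReciprocityDataInputs)
    (F : Type) [Field F] [ValuativeRel F] [TopologicalSpace F] [IsNonarchimedeanLocalField F] :
    nonempty_localEpsilonSystem F :=
  LocalLanglandsDatum.nonempty_localEpsilonSystem_of_nonempty h.1 F

open scoped MatrixGroups in
/-- **The exact residual content of `ReciprocityDataInputs`** (census form of the item, all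
threaded `LocalGaloisGroup` / `LocalConstants` facts taken at their discharged proofs and no
separate local Artin datum): the item holds if and only if, over every non-archimedean local field
`F` (in `Type`), there are a system of Deligne–Langlands local constants `𝓔` (the structure
`LocalEpsilonSystem F`; existence = Deligne 1973, Thm. 4.1, the named fact
`nonempty_localEpsilonSystem`) and a family
`rec_n : Irr(GL_n(F)) → {Frobenius-semisimple n-dimensional Weil–Deligne representations}/≅`
with the six-clause property `IsLocalLanglandsGL` (bijections; local class field theory at
`n = 1`; `L`- and `ε`-factors of pairs for generic pairs; twists; central characters — Harris–Taylor
2001, Thm. A (i)–(v) / Henniart 2000, Thm. 1.2), normalised by `𝓔`'s own Artin datum `𝓔.artin F`.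
Forward: a datum `L` supplies `𝓔 = L.eps`, `rec = L.recGL` (its Artin datum is `L.eps.artin F` by
`L.eps_artin`; the threaded hypotheses are propositions, so `L.isLocalLanglands` has the displayed
type).  Backward: the accepted assembly `LocalLanglandsDatum.nonempty_of_isLocalLanglandsGL` and
`ReciprocityDataInputs_iff_localLanglandsDatum_nonempty`.  Neither side is proved here: this is the
statement the item is blocked on, with every cheap component already removed. -/
theorem ReciprocityDataInputs_iff_forall_exists_isLocalLanglandsGL :
    Theses.TriangulineChamber.ReciprocityDataInputs ↔
      ∀ (F : Type) [Field F] [ValuativeRel F] [TopologicalSpace F] [IsNonarchimedeanLocalField F],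
        ∃ (𝓔 : LocalEpsilonSystem F)
          (rec : ∀ n : ℕ, IrrClass (GL (Fin n) F) → Quotient (frobSemisimpleWDSetoid F n)),
          IsLocalLanglandsGL F IsFrobPow.mul_holds IsFrobPow.unique_holds (absInertia_normal_holds F)
            (exists_isFrobPow_holds F)
            WeilGroup.exists_subgroup_le_inertia_isOpen_of_continuous_holds (𝓔.artin F) 𝓔 rec := by
  rw [ReciprocityDataInputs_iff_localLanglandsDatum_nonempty]
  refine ⟨fun h F _ _ _ _ => ?_, fun h F _ _ _ _ => ?_⟩
  · obtain ⟨L⟩ := h F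
    refine ⟨L.eps, L.recGL, ?_⟩
    have hL := L.isLocalLanglands
    rw [← L.eps_artin] at hL
    exact hL
  · obtain ⟨𝓔, rec, hrec⟩ := h F
    exact LocalLanglandsDatum.nonempty_of_isLocalLanglandsGL rfl hrec

end Summit.Langlands.Langlands.Theorems

end
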